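import Mathlib
import HarnessLib
import Summits.AtomisticToContinuum.FouriersLaw.Theses.LatticeLandauDamping
import Summits.AtomisticToContinuum.FouriersLaw.Theorems.EmbeddedDrudeMourreAbelOfSpectralDensity

/-!
# Birth skeleton (BC3) for crux `LatticeLandauDamping.PositiveDensity`
(item `stmt-AtomisticToContinuum-14014`, route `route-AtomisticToContinuum-LatticeLandauDamping`,
sub-problem `FouriersLaw`; registrar `planner-skel-stmt-AtomisticToContinuum-14014-0`, 2026-08-17)

Crux (FIXED, concluded BY NAME below): for `pinnedChain ω₂ lam β γ` (all `> 0`), every `T > 0`, every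
shift-invariant Gibbs state `μ_T`, every `μ_T`-preserving infinite-volume dynamics `D` with absolutely
convergent current correlations, every finite `σ` with `C_T(t) = ∫ cos(ωt) dσ(ω)` and every window
`(-δ, δ)` on which `σ = g dω` with `g` continuous `≥ 0` (no atom): `0 < g 0` — NOT AN INSULATOR.

## Line `birth` — the EINSTEIN–HELFAND FLOOR (time domain) + an Abelian–Tauberian step

Write `Φ_T(t) := ∫₀ᵗ (t - s) C_T(s) ds` (the Einstein–Helfand functional: for a stationary current with
autocorrelation `C_T`, `2 Φ_T(t) = ∫₀ᵗ∫₀ᵗ C_T(s - s') ds ds'` is the variance per unit length of the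
time-integrated total current `Q_t = ∫₀ᵗ J`, i.e. of the energy displacement; spectrally
`Φ_T(t) = ∫ (1 - cos ωt)/ω² dσ(ω) ≥ 0`).  Heat transport is (at least) diffusive iff `Φ_T(t) ≳ t`.

* `stub_einsteinHelfandFloor` (PHYSICS, the hard stub; open-problem class): for every admissible
  `(μ_T, D, σ)` there are `Dc > 0` and `K` with `Dc·t - K ≤ Φ_T(t)` for all `t ≥ 0` — the integrated
  current spreads at least diffusively (ballistic spreading, `Φ_T ∼ t²`, an atom of `σ` at `0`, is
  ALLOWED: this stub does not presuppose `NoDrudeWeight`; it fails exactly for an insulator,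
  `Φ_T(t) = o(t)`, e.g. a localised phase).  TRANSFER of the crux to the time domain: a lower bound on a
  non-negative quadratic (variance) functional of the dynamics, the form in which "conservation law +
  local decorrelation of the energy density ⇒ spreading" arguments, open-chain comparisons
  (conductance floors) and test-observable (slow-mode) variational bounds are run; none of these reads a
  pointwise value of a spectral density.
* `stub_abelFloorOfEinsteinHelfand` (REAL ANALYSIS, provable now, size M–L): if `σ` is finite,
  `C(t) = ∫ cos(ωt) dσ(ω)` and `Dc·t - K ≤ ∫₀ᵗ (t - s) C(s) ds` for all `t ≥ 0`, then for every `ν > 0`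
  `Dc - K·ν ≤ ∫_{t>0} e^{-νt} C(t) dt`.  Proof sketch: `C` is continuous and bounded by `σ(ℝ)`; Fubini on
  the triangle `0 < s < t` gives `∫₀^∞ e^{-νt} Φ(t) dt = ν⁻² ∫₀^∞ e^{-νs} C(s) ds` (inner integral
  `∫_s^∞ e^{-νt}(t - s) dt = e^{-νs}/ν²`; cf. `integral_exp_neg_mul_cosTransform` in the imported
  Poisson-kernel file), hence `∫₀^∞ e^{-νt}C = ν² ∫₀^∞ e^{-νt}Φ(t) dt ≥ ν² ∫₀^∞ e^{-νt}(Dc t - K) dt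
  = Dc - Kν`.
* COMPOSITION `PositiveDensity_of` (kernel-checked, sorry-free outside the stubs): stub 1 ⇒ `(Dc, K)`;
  stub 2 ⇒ `Dc - Kν ≤ ∫₀^∞ e^{-νt} C_T` for all `ν > 0`; the PROVED Poisson-kernel support
  `AbelOfSpectralDensity` (item 12598, `latticeLandauDamping_abelOfSpectralDensity_proof`) ⇒
  `∫₀^∞ e^{-νt} C_T → π g(0)` as `ν ↓ 0`; `le_of_tendsto_of_tendsto` ⇒ `Dc ≤ π g(0)` ⇒ `0 < g 0`.

Hardest stub: `stub_einsteinHelfandFloor` (it is the crux's physical content in Einstein–Helfand form;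
no lower bound on energy spreading is in print for a deterministic anharmonic chain — sources as on the
crux: BonettoLebowitzReyBellet2000, AokiLukkarinenSpohn2006, Dhar2008; threat: asymptotic localisation,
`Literature.Barriers.AtomisticToContinuum.DeRoeckHuveneers2015_thm2`, whose scope excludes this chain at
fixed `T > 0` but shows `Dc` cannot be bounded below uniformly at strong pinning).
Why the cut is not a costume: given the crux's window hypotheses, stub 1 ⟸ crux only through a
Fejér-type Tauberian argument and stub 1 ⟹ crux only through stub 2 + the Poisson-kernel lemma; the
BC3 probes `stub → PositiveDensity`, `stub → FouriersLaw` by `first | exact? | simpa | aesop` fail for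
both stubs (planner folder `bc/`, quoted in NOTES.md).  Stub 1 is stated for every admissible
`(μ_T, D, σ)` WITHOUT the window/no-atom hypotheses (it is insensitive to a Drude atom), so it is not
the crux with renamed variables.
Disproof used: none on file (`ledger crux ls stmt-AtomisticToContinuum-14014`: no `Disproof.lean`, no
`Negative/` lemma, 2026-08-17); refuter evidence `positiveDensity_iff_noSign` (the sign hypothesis on `g`
is redundant) is respected — neither stub uses the sign of `g`.
-/

noncomputable section

open MeasureTheory Filter Set Topology

namespace Summit.AtomisticToContinuum.FouriersLaw.Cruxes.PositiveDensity

namespace Birth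

/-- **stub 1 — `stub_einsteinHelfandFloor` (physics; NOT AN INSULATOR, Einstein–Helfand form).**
For the pinned anharmonic chain at `T > 0`, every shift-invariant Gibbs state `μ_T`, every
`μ_T`-preserving infinite-volume dynamics with absolutely convergent current correlations and every
finite spectral measure `σ` of the summed current autocorrelation `C_T(t) = ∫ cos(ωt) dσ(ω)`, the
Einstein–Helfand functional `Φ_T(t) = ∫₀ᵗ (t - s) C_T(s) ds` (half the variance per unit length of the
time-integrated total current) grows at least linearly: `Dc·t - K ≤ Φ_T(t)` for all `t ≥ 0`, some
`Dc > 0`.  Open (no spreading lower bound is proved for any deterministic anharmonic chain); allows a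
Drude atom (ballistic spreading); false exactly for an insulator. -/
theorem stub_einsteinHelfandFloor :
    ∀ ω₂ lam β γ : ℝ, 0 < ω₂ → 0 < lam → 0 < β → 0 < γ → ∀ T : ℝ, 0 < T →
    ∀ (μT : MeasureTheory.Measure Literature.MathematicalPhysics.KineticTheory.HeatConduction.ChainConfig)
      (D : Literature.MathematicalPhysics.KineticTheory.HeatConduction.InfiniteChainDynamics
        (Literature.MathematicalPhysics.KineticTheory.HeatConduction.pinnedChain ω₂ lam β γ)),
      (Literature.MathematicalPhysics.KineticTheory.HeatConduction.pinnedChain ω₂ lam β γ).IsChainGibbsMeasure T μT →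
      (∀ x : ℤ, MeasureTheory.MeasurePreserving
        (fun σ : Literature.MathematicalPhysics.KineticTheory.HeatConduction.ChainConfig => fun i : ℤ => σ (i + x)) μT μT) →
      D.PreservesMeasure μT → (∀ t : ℝ, D.HasAbsConvergentCorrelation μT t) →
    ∀ σ : MeasureTheory.Measure ℝ, MeasureTheory.IsFiniteMeasure σ →
      (∀ t : ℝ, D.currentCorrelation μT t = MeasureTheory.integral σ (fun ω : ℝ => Real.cos (ω * t))) →
    ∃ Dc K : ℝ, 0 < Dc ∧ ∀ t : ℝ, 0 ≤ t →
      Dc * t - K ≤ intervalIntegral (fun s : ℝ => (t - s) * D.currentCorrelation μT s) 0 t MeasureTheory.volume := by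
  sorry

/-- **stub 2 — `stub_abelFloorOfEinsteinHelfand` (real analysis, provable now; Abelian step of the
Einstein–Helfand ⇒ Green–Kubo direction).**  If `σ` is a finite measure on `ℝ`, `C(t) = ∫ cos(ωt) dσ(ω)`
and `Dc·t - K ≤ ∫₀ᵗ (t - s) C(s) ds` for all `t ≥ 0`, then `Dc - K·ν ≤ ∫_{t>0} e^{-νt} C(t) dt` for every
`ν > 0` (Fubini: `∫₀^∞ e^{-νt} C = ν² ∫₀^∞ e^{-νt} (∫₀ᵗ (t - s) C(s) ds) dt ≥ ν² ∫₀^∞ e^{-νt}(Dc t - K) dt`). -/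
theorem stub_abelFloorOfEinsteinHelfand :
    ∀ (σ : MeasureTheory.Measure ℝ) (C : ℝ → ℝ) (Dc K : ℝ), MeasureTheory.IsFiniteMeasure σ →
      (∀ t : ℝ, C t = MeasureTheory.integral σ (fun ω : ℝ => Real.cos (ω * t))) →
      (∀ t : ℝ, 0 ≤ t → Dc * t - K ≤ intervalIntegral (fun s : ℝ => (t - s) * C s) 0 t MeasureTheory.volume) →
      ∀ ν : ℝ, 0 < ν →
        Dc - K * ν ≤ MeasureTheory.integral (MeasureTheory.volume.restrict (Set.Ioi (0:ℝ)))
          (fun t : ℝ => Real.exp (-(ν * t)) * C t) := by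
  sorry

/-- **Skeleton theorem — the crux `LatticeLandauDamping.PositiveDensity` BY NAME** from the two stubs
and the proved Poisson-kernel support (item 12598): `Dc - Kν ≤ ∫₀^∞ e^{-νt} C_T → π g(0)` as `ν ↓ 0`,
so `0 < Dc ≤ π g(0)` and `0 < g 0`. -/
theorem PositiveDensity_of :
    Summit.AtomisticToContinuum.FouriersLaw.Theses.LatticeLandauDamping.PositiveDensity := by
  intro ω₂ lam β γ hω hl hβ hγ T hT μT D hGibbs hshift hpres habs σ δ g hfin hδ hC hg hg0 hres
  -- stub 1: the Einstein–Helfand floor `Dc·t - K ≤ Φ_T(t)`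
  obtain ⟨Dc, K, hDc, hfloor⟩ :=
    stub_einsteinHelfandFloor ω₂ lam β γ hω hl hβ hγ T hT μT D hGibbs hshift hpres habs σ hfin hC
  -- stub 2: the Abelian floor `Dc - Kν ≤ ∫₀^∞ e^{-νt} C_T(t) dt`
  have habel : ∀ ν : ℝ, 0 < ν → Dc - K * ν ≤
      MeasureTheory.integral (MeasureTheory.volume.restrict (Set.Ioi (0:ℝ)))
        (fun t : ℝ => Real.exp (-(ν * t)) * D.currentCorrelation μT t) :=
    stub_abelFloorOfEinsteinHelfand σ (D.currentCorrelation μT) Dc K hfin hC hfloor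
  -- the PROVED Poisson-kernel lemma (support AbelOfSpectralDensity, item 12598): Abel means → π·g 0
  have hlim := Summit.AtomisticToContinuum.FouriersLaw.Theorems.AbelOfSpectralDensity.latticeLandauDamping_abelOfSpectralDensity_proof
    σ (D.currentCorrelation μT) δ g hfin hδ hC hg hg0 hres
  -- the affine minorant tends to `Dc`
  have hlin : Filter.Tendsto (fun ν : ℝ => Dc - K * ν) (nhdsWithin (0:ℝ) (Set.Ioi 0)) (nhds Dc) := by
    have h : Filter.Tendsto (fun ν : ℝ => Dc - K * ν) (nhds (0:ℝ)) (nhds (Dc - K * 0)) :=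
      Continuous.tendsto (by fun_prop) 0
    simp only [mul_zero, sub_zero] at h
    exact h.mono_left nhdsWithin_le_nhds
  have hle : Dc ≤ Real.pi * g 0 := by
    refine le_of_tendsto_of_tendsto hlin hlim ?_
    filter_upwards [self_mem_nhdsWithin] with ν hν using habel ν hν
  have hπg : 0 < Real.pi * g 0 := lt_of_lt_of_le hDc hle
  nlinarith [hπg, Real.pi_pos]

end Birth

end Summit.AtomisticToContinuum.FouriersLaw.Cruxes.PositiveDensity

end
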